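import Summits.QuantumFields.QCD.Theorems.WilsonMobilityGapMobilityGapWilsonPointwiseCoercive
import Summits.QuantumFields.QCD.Theorems.MobilityGap.Negative.LowerPin
import Literature.MathematicalPhysics.QuantumFieldTheory.QCDPropagatorDiagonalLowerBound
import Literature.MathematicalPhysics.QuantumFieldTheory.QCDPropagatorParity

/-!
# The `n = 0` instance of clause (iii) is deterministic at positive lattice-light bare mass
# (crux `MobilityGap`, stmt-QuantumFields-9150, line `Sketch`; lead c5, 2026-08-16)

The tree's `re_inv_wilsonDirac_apply_self_ge` gives `Re (D_W(U,m,1)⁻¹)_{ee} ≥ m/(m+8)²` at positive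
bare mass — an amplitude that vanishes as `m ↓ 0`, hence NOT `k`-uniform along a lattice-light
trajectory `m ≍ a_k`.  Pointwise coercivity (`wilson_pointwise_coercive`) removes the degeneration:

* `re_inv_wilsonDirac_apply_self_ge_unif` — there is an absolute `c₀ > 0` with
  `c₀ ≤ Re (D_W(U,m,1)⁻¹)_{ee}` for EVERY `SU(3)` field, every index `e`, every `0 < m ≤ 1` and
  every torus with `m L⁴ ≥ 1`.  Proof: with `ψ := D⁻¹ e` (column), pointwise coercivity at EVERY
  index `q` gives `|ψ_q|² ≤ K · Re⟨ψ, Dψ⟩ = K · Re ψ_e`; the row sum rule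
  `1 ≤ |m+4| |G_{ee}| + Σ_{q ∼ e} |G_{eq}|` (`wilsonPropagator_row_sumRule`) and γ₅-hermiticity
  `|G_{eq}| = |G_{qe}| = |ψ_q|` (`norm_inv_wilsonDirac_apply_comm`) then give
  `1 ≤ 101 √(K Re ψ_e)`, i.e. `Re ψ_e ≥ 1/(101² K)`.
* `phaseQuenched_diagMoment_ge_unif` — integrated: `c^s ≤ E_{|w|,β,S}[(Σ|G_f(0,0)|)^s]` with `c`
  INDEPENDENT of the masses, for all positive bare tuples with `m_f ≤ 1`, `m_f (2S+1)⁴ ≥ 1`.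
* `lower_at_zero_of_eventually_pos_light` — hence along every regularisation whose bare masses are
  eventually in `[c a_k, 1]` (in particular the lattice-light junk witness of
  `exists_light_witness_without_lower`), the `n = 0` instance of clause (iii) LOWER holds with a
  `k`-uniform constant.  The content of `MobilityGap` is clause (iii) at separations `n ≥ 1`.

Pure theorem file (no definitions).
-/

noncomputable section

namespace Summit.QuantumFields.QCD.Theorems.MobilityGapPositiveMass

open scoped BigOperators Topology ComplexConjugate
open MeasureTheory Filter Set Matrix
open Literature.MathematicalPhysics.QuantumFieldTheory Literature.MathematicalPhysics.QuantumLattice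
  Literature.Probability.LatticeModels
open Summit.QuantumFields.QCD.Theorems.MobilityGapNegative

/-! ### The configuration-wise uniform lower bound on the diagonal -/

/-- **Uniform lower bound on the diagonal of the Wilson quark propagator at positive lattice-light
mass.**  There is an absolute `c₀ > 0` such that for every torus side `L`, every `SU(3)` gauge field
`U`, every bare mass `0 < m ≤ 1` with `1 ≤ m L⁴` and every index `e`:
`c₀ ≤ Re (D_W(U,m,1)⁻¹)_{ee}` (`c₀ = 1/(101² K)`, `K` the pointwise-coercivity constant). [folklore] -/
theorem re_inv_wilsonDirac_apply_self_ge_unif :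
    ∃ c₀ : ℝ, 0 < c₀ ∧ ∀ (L : ℕ) [NeZero L] (U : GaugeConfig 4 L (Matrix.specialUnitaryGroup (Fin 3) ℂ))
      (m : ℝ), 0 < m → m ≤ 1 → 1 ≤ m * (L : ℝ) ^ 4 → ∀ e : TorusSite 4 L × Fin 3 × Fin 4,
        c₀ ≤ ((wilsonDirac (fundamentalRep (Fin 3)) U m 1)⁻¹ e e).re := by
  obtain ⟨K, hK, hpc⟩ := wilson_pointwise_coercive
  refine ⟨1 / (101 ^ 2 * K), by positivity, ?_⟩
  intro L _ U m hm hm1 hmL e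
  have hρ : ∀ g : Matrix.specialUnitaryGroup (Fin 3) ℂ,
      fundamentalRep (Fin 3) g ∈ Matrix.unitaryGroup (Fin 3) ℂ := fundamentalRep_mem_unitaryGroup
  set W := wilsonDirac (fundamentalRep (Fin 3)) U m 1 with hW
  have hdet : W.det ≠ 0 := wilsonDirac_det_ne_zero_of_pos (fundamentalRep (Fin 3)) hρ U hm
  -- the `e`-th column of the propagator
  set ψ : TorusSite 4 L × Fin 3 × Fin 4 → ℂ := fun i => W⁻¹ i e with hψdef
  have hcol : W⁻¹ *ᵥ Pi.single e 1 = ψ := by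
    rw [Matrix.mulVec_single_one]
    rfl
  have hWψ : W *ᵥ ψ = Pi.single e 1 := by
    rw [← hcol, Matrix.mulVec_mulVec, Matrix.mul_nonsing_inv _ (isUnit_iff_ne_zero.2 hdet),
      Matrix.one_mulVec]
  -- the form at `ψ` is `conj ψ_e`
  have hform : (∑ i, star (ψ i) * (W *ᵥ ψ) i) = star (ψ e) := by
    rw [hWψ, Finset.sum_eq_single e]
    · simp
    · intro i _ hi
      simp [hi]
    · intro h
      exact absurd (Finset.mem_univ e) h
  set R : ℝ := (ψ e).re with hR
  -- pointwise coercivity at every index `q`: `|ψ_q|² ≤ K R`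
  have hpt : ∀ q, ‖ψ q‖ ^ 2 ≤ K * R := by
    intro q
    have h := hpc L U m hm hmL ψ q
    rw [hform] at h
    have hre : (star (ψ e)).re = R := by rw [hR]; simp
    rw [hre] at h
    have hS : 0 ≤ m / 2 * ∑ i, ‖ψ i‖ ^ 2 := by
      have : 0 ≤ ∑ i, ‖ψ i‖ ^ 2 := Finset.sum_nonneg fun _ _ => by positivity
      positivity
    have h1 : ‖ψ q‖ ^ 2 / K ≤ R := by linarith
    rwa [div_le_iff₀ hK, mul_comm] at h1
  have hR0 : 0 ≤ R := by
    have := hpt e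
    nlinarith [sq_nonneg ‖ψ e‖, hK]
  have hsq : ∀ q, ‖ψ q‖ ≤ Real.sqrt (K * R) := fun q =>
    Real.le_sqrt_of_sq_le (hpt q)
  -- the row sum rule at `e`, with `|G_{eq}| = |G_{qe}| = |ψ_q|`
  obtain ⟨x, a, i⟩ := e
  have hrow := wilsonPropagator_row_sumRule (fundamentalRep (Fin 3)) hρ U m hdet x a i
  have hsym : ∀ q, ‖W⁻¹ (x, a, i) q‖ = ‖ψ q‖ := fun q => by
    rw [hψdef]
    exact norm_inv_wilsonDirac_apply_comm (fundamentalRep (Fin 3)) hρ U m 1 (x, a, i) q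
  set s : ℝ := Real.sqrt (K * R) with hs
  have hs0 : 0 ≤ s := Real.sqrt_nonneg _
  have hm4 : |m + 4| ≤ 5 := by rw [abs_of_pos (by linarith)]; linarith
  have h1 : |m + 4| * ‖W⁻¹ (x, a, i) (x, a, i)‖ ≤ 5 * s := by
    rw [hsym]
    exact mul_le_mul hm4 (hsq _) (norm_nonneg _) (by norm_num)
  have h2 : ∀ μ : Fin 4, ((∑ b : Fin 3, ∑ j : Fin 4, ‖W⁻¹ (x, a, i) (x + Pi.single μ 1, b, j)‖) +
      (∑ b : Fin 3, ∑ j : Fin 4, ‖W⁻¹ (x, a, i) (x - Pi.single μ 1, b, j)‖)) ≤ 24 * s := by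
    intro μ
    have hA : ∑ b : Fin 3, ∑ j : Fin 4, ‖W⁻¹ (x, a, i) (x + Pi.single μ 1, b, j)‖ ≤ 12 * s := by
      calc _ ≤ ∑ _b : Fin 3, ∑ _j : Fin 4, s :=
            Finset.sum_le_sum fun b _ => Finset.sum_le_sum fun j _ => by rw [hsym]; exact hsq _
        _ = 12 * s := by simp; ring
    have hB : ∑ b : Fin 3, ∑ j : Fin 4, ‖W⁻¹ (x, a, i) (x - Pi.single μ 1, b, j)‖ ≤ 12 * s := by
      calc _ ≤ ∑ _b : Fin 3, ∑ _j : Fin 4, s :=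
            Finset.sum_le_sum fun b _ => Finset.sum_le_sum fun j _ => by rw [hsym]; exact hsq _
        _ = 12 * s := by simp; ring
    linarith
  have h3 : (1 : ℝ) ≤ 101 * s := by
    have h2' : ∑ μ : Fin 4, ((∑ b : Fin 3, ∑ j : Fin 4, ‖W⁻¹ (x, a, i) (x + Pi.single μ 1, b, j)‖) +
        (∑ b : Fin 3, ∑ j : Fin 4, ‖W⁻¹ (x, a, i) (x - Pi.single μ 1, b, j)‖)) ≤ ∑ _μ : Fin 4, 24 * s :=
      Finset.sum_le_sum fun μ _ => h2 μ
    have h2'' : ∑ _μ : Fin 4, 24 * s = 96 * s := by simp; ring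
    linarith [hrow, h1, h2', h2'']
  -- `1 ≤ 101² K R`
  have h4 : (1 : ℝ) ≤ 101 ^ 2 * (K * R) := by
    have h5 : (1 : ℝ) ≤ (101 * s) ^ 2 := by nlinarith
    rw [mul_pow, hs, Real.sq_sqrt (by positivity)] at h5
    linarith
  show 1 / (101 ^ 2 * K) ≤ R
  rw [div_le_iff₀ (by positivity)]
  linarith

/-- **Uniform lower bound on the same-site colour–spin block sum**: `12 c₀ ≤ Σ_{a,i,b,j} |G((x,a,i),(x,b,j))|`
for `0 < m ≤ 1`, `m L⁴ ≥ 1`, every field and site. [folklore] -/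
theorem diag_blockSum_ge_unif :
    ∃ c : ℝ, 0 < c ∧ ∀ (L : ℕ) [NeZero L] (U : GaugeConfig 4 L (Matrix.specialUnitaryGroup (Fin 3) ℂ))
      (m : ℝ), 0 < m → m ≤ 1 → 1 ≤ m * (L : ℝ) ^ 4 → ∀ x : TorusSite 4 L,
        c ≤ ∑ a : Fin 3, ∑ i : Fin 4, ∑ b : Fin 3, ∑ j : Fin 4,
          ‖(wilsonDirac (fundamentalRep (Fin 3)) U m 1)⁻¹ (x, a, i) (x, b, j)‖ := by
  obtain ⟨c₀, hc₀, h⟩ := re_inv_wilsonDirac_apply_self_ge_unif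
  refine ⟨12 * c₀, by positivity, ?_⟩
  intro L _ U m hm hm1 hmL x
  have hdiag : ∀ (a : Fin 3) (i : Fin 4),
      c₀ ≤ ‖(wilsonDirac (fundamentalRep (Fin 3)) U m 1)⁻¹ (x, a, i) (x, a, i)‖ := fun a i =>
    (h L U m hm hm1 hmL (x, a, i)).trans (Complex.re_le_norm _)
  calc 12 * c₀ = ∑ _a : Fin 3, ∑ _i : Fin 4, c₀ := by simp; ring
    _ ≤ ∑ a : Fin 3, ∑ i : Fin 4, ‖(wilsonDirac (fundamentalRep (Fin 3)) U m 1)⁻¹ (x, a, i) (x, a, i)‖ :=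
        Finset.sum_le_sum fun a _ => Finset.sum_le_sum fun i _ => hdiag a i
    _ ≤ _ := by
        refine Finset.sum_le_sum fun a _ => Finset.sum_le_sum fun i _ => ?_
        calc ‖(wilsonDirac (fundamentalRep (Fin 3)) U m 1)⁻¹ (x, a, i) (x, a, i)‖
            ≤ ∑ j : Fin 4, ‖(wilsonDirac (fundamentalRep (Fin 3)) U m 1)⁻¹ (x, a, i) (x, a, j)‖ :=
              Finset.single_le_sum
                (f := fun j : Fin 4 => ‖(wilsonDirac (fundamentalRep (Fin 3)) U m 1)⁻¹ (x, a, i) (x, a, j)‖)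
                (fun _ _ => norm_nonneg _) (Finset.mem_univ i)
          _ ≤ ∑ b : Fin 3, ∑ j : Fin 4, ‖(wilsonDirac (fundamentalRep (Fin 3)) U m 1)⁻¹ (x, a, i) (x, b, j)‖ :=
              Finset.single_le_sum
                (f := fun b : Fin 3 => ∑ j : Fin 4,
                  ‖(wilsonDirac (fundamentalRep (Fin 3)) U m 1)⁻¹ (x, a, i) (x, b, j)‖)
                (fun _ _ => Finset.sum_nonneg fun _ _ => norm_nonneg _) (Finset.mem_univ a)

/-! ### The phase-quenched `n = 0` moment, uniformly in the masses -/

/-- **The same-site phase-quenched fractional moment is bounded below by an ABSOLUTE constant at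
positive lattice-light masses**: there is `c > 0` such that for all positive bare tuples `mq`, every
flavour `f` with `mq f ≤ 1`, every `S` with `1 ≤ mq f (2S+1)⁴`, every `β` and `s ∈ [0,1]`,
`c ≤ E_{|w|,β,S}[(Σ_{a,i,b,j}|G_f((0,a,i),(0,b,j))|)^s]` (measure-theoretic template: the tree's
`phaseQuenched_diagMoment_ge_of_pos`). [folklore] -/
theorem phaseQuenched_diagMoment_ge_unif :
    ∃ c : ℝ, 0 < c ∧ c ≤ 1 ∧ ∀ (Nf : ℕ) (β : ℝ) (mq : Fin Nf → ℝ), (∀ g, 0 < mq g) →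
      ∀ (S : ℕ) (f : Fin Nf), mq f ≤ 1 → 1 ≤ mq f * ((2 * S + 1 : ℕ) : ℝ) ^ 4 → ∀ s : ℝ, 0 ≤ s → s ≤ 1 →
        c ≤ (∫ U : GaugeConfig 4 (2 * S + 1) (Matrix.specialUnitaryGroup (Fin 3) ℂ),
            ‖(diracMatrix U mq).det‖ *
              (∑ a : Fin 3, ∑ i : Fin 4, ∑ b : Fin 3, ∑ j : Fin 4,
                ‖(diracMatrix U mq)⁻¹ (quarkEquiv (f, (Torus.proj (2 * S + 1) 0, a, i)))
                  (quarkEquiv (f, (Torus.proj (2 * S + 1) 0, b, j)))‖) ^ s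
            ∂(wilsonMeasure (fundamentalRep (Fin 3)) β)) /
          (∫ U : GaugeConfig 4 (2 * S + 1) (Matrix.specialUnitaryGroup (Fin 3) ℂ),
            ‖(diracMatrix U mq).det‖ ∂(wilsonMeasure (fundamentalRep (Fin 3)) β)) := by
  obtain ⟨c₁, hc₁, hblock⟩ := diag_blockSum_ge_unif
  refine ⟨min c₁ 1, by positivity, min_le_right _ _, ?_⟩
  intro Nf β mq hpos S f hm1 hvol s hs0 hs1
  set c : ℝ := min c₁ 1 with hc
  have hc0 : 0 ≤ c := by positivity
  have hcle : c ≤ c₁ := min_le_left _ _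
  have hc1 : c ≤ 1 := min_le_right _ _
  set X : GaugeConfig 4 (2 * S + 1) SU3 → ℝ := fun U =>
    ∑ a : Fin 3, ∑ i : Fin 4, ∑ b : Fin 3, ∑ j : Fin 4,
      ‖(diracMatrix U mq)⁻¹ (quarkEquiv (f, (Torus.proj (2 * S + 1) 0, a, i)))
        (quarkEquiv (f, (Torus.proj (2 * S + 1) 0, b, j)))‖ with hX
  have hdetW : ∀ (U : GaugeConfig 4 (2 * S + 1) SU3) (g : Fin Nf),
      (wilsonDirac (fundamentalRep (Fin 3)) U (mq g) 1).det ≠ 0 := fun U g =>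
    wilsonDirac_det_ne_zero_of_pos (fundamentalRep (Fin 3)) fundamentalRep_mem_unitaryGroup U (hpos g)
  have hdet : ∀ U : GaugeConfig 4 (2 * S + 1) SU3, (diracMatrix U mq).det ≠ 0 := fun U =>
    det_diracMatrix_ne_zero_of_pos U mq hpos
  have hZ : 0 < ∫ U : GaugeConfig 4 (2 * S + 1) SU3, ‖(diracMatrix U mq).det‖
      ∂(wilsonMeasure (fundamentalRep (Fin 3)) β) :=
    integral_norm_det_diracMatrix_pos_of_exists β mq ⟨fun _ => 1, hdet _⟩
  -- configuration-wise lower bound `c ≤ X U`, hence `c ≤ X U ^ s` (`c ≤ 1`, `s ≤ 1`)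
  have hXge : ∀ U, c ≤ X U := by
    intro U
    have h := hblock (2 * S + 1) U (mq f) (hpos f) hm1 hvol (Torus.proj (2 * S + 1) 0)
    have hX' : X U = ∑ a : Fin 3, ∑ i : Fin 4, ∑ b : Fin 3, ∑ j : Fin 4,
        ‖(wilsonDirac (fundamentalRep (Fin 3)) U (mq f) 1)⁻¹ (Torus.proj (2 * S + 1) 0, a, i)
          (Torus.proj (2 * S + 1) 0, b, j)‖ := by
      simp only [hX, inv_diracMatrix_apply_same_flavour U mq (hdetW U) f]
    rw [hX']
    exact hcle.trans h
  have hX0 : ∀ U, 0 ≤ X U := fun U => hc0.trans (hXge U)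
  have hcpos : 0 < c := by positivity
  have hXs : ∀ U, c ≤ X U ^ s := by
    intro U
    have hXpos : 0 < X U := hcpos.trans_le (hXge U)
    rcases le_or_gt 1 (X U) with hge | hlt
    · exact hc1.trans (Real.one_le_rpow hge hs0)
    · calc c ≤ X U := hXge U
        _ = X U ^ (1 : ℝ) := (Real.rpow_one _).symm
        _ ≤ X U ^ s := Real.rpow_le_rpow_of_exponent_ge hXpos hlt.le hs1
  -- configuration-wise upper bound (integrability only): the heavy bound at the lightest flavour
  obtain ⟨g₀, -, hg₀⟩ := Finset.exists_min_image Finset.univ mq ⟨f, Finset.mem_univ f⟩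
  have hm₀ : 0 < mq g₀ := hpos g₀
  have hM : ∀ g, mq g₀ ≤ mq g := fun g => hg₀ g (Finset.mem_univ g)
  have hXle : ∀ U, X U ≤ 144 * (mq g₀)⁻¹ := by
    intro U
    have hentry : ∀ (a : Fin 3) (i : Fin 4) (b : Fin 3) (j : Fin 4),
        ‖(diracMatrix U mq)⁻¹ (quarkEquiv (f, (Torus.proj (2 * S + 1) 0, a, i)))
          (quarkEquiv (f, (Torus.proj (2 * S + 1) 0, b, j)))‖ ≤ (mq g₀)⁻¹ := by
      intro a i b j
      refine (norm_inv_diracMatrix_apply_le_of_le U mq hm₀ hM f _ _ 0).trans ?_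
      have hθ0 : 0 ≤ 4 / (mq g₀ + 4) := by positivity
      have hθ1 : 4 / (mq g₀ + 4) ≤ 1 := by rw [div_le_one (by linarith)]; linarith
      calc (mq g₀)⁻¹ * (4 / (mq g₀ + 4)) ^ _ ≤ (mq g₀)⁻¹ * 1 :=
            mul_le_mul_of_nonneg_left (pow_le_one₀ hθ0 hθ1) (inv_nonneg.2 hm₀.le)
        _ = (mq g₀)⁻¹ := mul_one _
    calc X U ≤ ∑ _a : Fin 3, ∑ _i : Fin 4, ∑ _b : Fin 3, ∑ _j : Fin 4, (mq g₀)⁻¹ :=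
          Finset.sum_le_sum fun a _ => Finset.sum_le_sum fun i _ => Finset.sum_le_sum fun b _ =>
            Finset.sum_le_sum fun j _ => hentry a i b j
      _ = 144 * (mq g₀)⁻¹ := by simp; ring
  -- measurability and integrability of the weighted moment
  have hXm : Measurable X := by
    refine Finset.measurable_sum _ fun a _ => Finset.measurable_sum _ fun i _ =>
      Finset.measurable_sum _ fun b _ => Finset.measurable_sum _ fun j _ => ?_
    exact (measurable_inv_diracMatrix_apply mq _ _).norm
  have hint : Integrable (fun U => ‖(diracMatrix U mq).det‖ * X U ^ s)
      (wilsonMeasure (fundamentalRep (Fin 3)) β) := by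
    refine integrable_norm_det_diracMatrix_mul β mq (fun U => X U ^ s)
      ((Real.continuous_rpow_const hs0).measurable.comp hXm).aestronglyMeasurable
      (C := (144 * (mq g₀)⁻¹) ^ s) fun U => ?_
    rw [Real.norm_eq_abs, abs_of_nonneg (Real.rpow_nonneg (hX0 U) _)]
    exact Real.rpow_le_rpow (hX0 U) (hXle U) hs0
  -- assemble
  have hnum : (∫ U : GaugeConfig 4 (2 * S + 1) SU3, ‖(diracMatrix U mq).det‖
        ∂(wilsonMeasure (fundamentalRep (Fin 3)) β)) * c ≤
      ∫ U : GaugeConfig 4 (2 * S + 1) SU3, ‖(diracMatrix U mq).det‖ * X U ^ s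
        ∂(wilsonMeasure (fundamentalRep (Fin 3)) β) := by
    rw [← integral_mul_const]
    refine integral_mono_of_nonneg (Eventually.of_forall fun U => ?_) hint
      (Eventually.of_forall fun U => ?_)
    · exact mul_nonneg (norm_nonneg _) hc0
    · exact mul_le_mul_of_nonneg_left (hXs U) (norm_nonneg _)
  show c ≤ (∫ U : GaugeConfig 4 (2 * S + 1) SU3, ‖(diracMatrix U mq).det‖ * X U ^ s
      ∂(wilsonMeasure (fundamentalRep (Fin 3)) β)) /
    (∫ U : GaugeConfig 4 (2 * S + 1) SU3, ‖(diracMatrix U mq).det‖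
      ∂(wilsonMeasure (fundamentalRep (Fin 3)) β))
  rw [le_div_iff₀ hZ]
  exact (mul_comm _ _).trans_le hnum

/-! ### The `n = 0` instance of clause (iii) along positive lattice-light trajectories -/

/-- **The `n = 0` instance of clause (iii) LOWER is deterministic along positive lattice-light
trajectories.**  If all realised bare masses of `(reg, m)` lie in `[c a_k, 1]` eventually (`c > 0`),
then for every `s ∈ (0,1)` there is a `k`-UNIFORM `c₀ > 0` with
`c₀ ≤ E_{|w|,β_k,S}[(Σ|G_f(0,0)|)^s]` for all large `k`, all `S ≥ L_k` and all flavours — the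
`n = 0` entry of the lower pin, for EVERY coupling sequence.  In particular the light junk witness of
`exists_light_witness_without_lower` satisfies it; only the entries `n ≥ 1` of clause (iii) carry the
content of the crux. [folklore] -/
theorem lower_at_zero_of_eventually_pos_light {Nf : ℕ} (reg : QCDRegularisation Nf) (m : Fin Nf → ℝ)
    (hpos : ∃ c : ℝ, 0 < c ∧ ∀ᶠ k in atTop, ∀ f, c * reg.a k ≤ bare reg m k f ∧ bare reg m k f ≤ 1)
    (s : ℝ) (hs0 : 0 < s) (hs1 : s < 1) :
    ∃ c₀ : ℝ, 0 < c₀ ∧ ∀ᶠ k in atTop, ∀ S : ℕ, reg.L k ≤ S → ∀ f : Fin Nf,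
      c₀ ≤ fm Nf (reg.β k) (bare reg m k) S f (Pi.single 0 ((0 : ℕ) : ℤ)) s := by
  obtain ⟨c₁, hc₁, -, hbound⟩ := phaseQuenched_diagMoment_ge_unif
  obtain ⟨c, hc, hk⟩ := hpos
  refine ⟨c₁, hc₁, ?_⟩
  have hvol : ∀ᶠ k in atTop, 1 ≤ c * (reg.a k * reg.L k) :=
    (reg.tendsto_L.eventually_ge_atTop (1 / c)).mono fun k hk => by
      rwa [div_le_iff₀' hc] at hk
  filter_upwards [hk, hvol] with k hk hvk S hS f
  have ha := reg.a_pos k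
  have hposk : ∀ g, 0 < bare reg m k g := fun g => lt_of_lt_of_le (mul_pos hc ha) (hk g).1
  have hS1 : (reg.L k : ℝ) ≤ ((2 * S + 1 : ℕ) : ℝ) ^ 4 := by
    have h1 : (reg.L k : ℝ) ≤ ((2 * S + 1 : ℕ) : ℝ) := by exact_mod_cast (by omega : reg.L k ≤ 2 * S + 1)
    have h2 : (1 : ℝ) ≤ ((2 * S + 1 : ℕ) : ℝ) := by exact_mod_cast (by omega : 1 ≤ 2 * S + 1)
    calc (reg.L k : ℝ) ≤ ((2 * S + 1 : ℕ) : ℝ) := h1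
      _ = ((2 * S + 1 : ℕ) : ℝ) ^ 1 := (pow_one _).symm
      _ ≤ ((2 * S + 1 : ℕ) : ℝ) ^ 4 := pow_le_pow_right₀ h2 (by norm_num)
  have hvolS : 1 ≤ bare reg m k f * ((2 * S + 1 : ℕ) : ℝ) ^ 4 := by
    calc (1 : ℝ) ≤ c * (reg.a k * reg.L k) := hvk
      _ = (c * reg.a k) * reg.L k := by ring
      _ ≤ bare reg m k f * ((2 * S + 1 : ℕ) : ℝ) ^ 4 :=
          mul_le_mul (hk f).1 hS1 (Nat.cast_nonneg _) (hposk f).le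
  have h := hbound Nf (reg.β k) (bare reg m k) hposk S f (hk f).2 hvolS s hs0.le hs1.le
  have h0 : Torus.proj (2 * S + 1) (Pi.single 0 ((0 : ℕ) : ℤ) : Literature.Probability.LatticeModels.Site 4) =
      Torus.proj (2 * S + 1) (0 : Literature.Probability.LatticeModels.Site 4) := by
    simp
  unfold fm
  rw [h0]
  exact h

end Summit.QuantumFields.QCD.Theorems.MobilityGapPositiveMass

end
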